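import Summits.HodgeConjecture.HodgeConjecture.Theorems.F0P3XiPacketFamilyOfRecord        -- ★ F0P3-p01 (g7): THE ξ-LOCAL FAMILY OF RECORD ED. 2 `xiPacketFamilyOfRecord` (+ ★ `CMLocalCharacterIdentities`: `.πs`, `.πs_isSupercuspidal`, `.πs_ne`, `.charIdentityAt_πs`)
import Literature.NumberTheory.Rogawski1990.CMThetaDockingClauses                          -- ★ the theta-docking clause `CMThetaDockingClauses` (a HYPOTHESIS here)
import Literature.NumberTheory.GelbartRogawski1991.XiLocalPacketNonsplitThetaPair          -- ★ p826161: the letter #75-loc `xiLocalPacket_nonsplit_isThetaPair` (a HYPOTHESIS here; ★ p829745 proves it from five letters)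
import HarnessLib

/-!
# Crux `H413`, programme P2 — ROW (R3) «D7α CLASS-LEVEL GLUE»: every member of the ξ-local PACKET FAMILY OF RECORD at a non-split place is a
# CM theta type — from the local theta dichotomy #75-loc and the theta-DOCKING clause (`d7alpha_members_thetaClass`)

Cell hodgecm-mathlib (D-0151), FLOOR 0, crux item H413 = stmt-HodgeConjecture-24833, route of record `HCCMUnconditional`; programme P2; desk F0P2-plan (g8)
row (R3) (2026-08-31), the class-level glue (iv) of the «D7α-MEM CENSUS» `F0/P2/B-p14/g27/CENSUS-D7alpha-MEM.B-p14g27.md` (19166c0af0763e8a) for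
tomorrow's PKΠ v1.7 «D7α SPLIT».  Lines-free, THEOREMS ONLY (no definition, no named fact, no instance, no notation, no `sorry`); kernel lane helper on
24833.  HC_CM is proved only modulo the printed citations until rung 0 closes; this file proves no letter — it composes two hypotheses BY NAME.

THE STATEMENT.  Frame: CM `L`, hermitian `H` (`hH`, `hHd`), Rogawski's unitary `μω`, and — SHARED TOKEN FOR TOKEN with ★ `F0P3XiPacketFamilyOfRecord` (its §2
`variable` block) — the local transfer data `(Δ, mH, mG, νG, νH, ξloc, μZ)`, the Keys data `keys` and the non-split character-identity clause `hCM`; a theta frame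
`ᵗ(c̄ g) H g = diag dV`; a one-dimensional automorphic `ξ` of `H`; a dictionary pair `(μ1, χ_f)` on the two DICTIONARY equations of letter #76; a NON-SPLIT
finite place `v` with a Borel Haar measure `μZ v` on `U(Φ₃)(L⁺_v) ⧸ Z`.  HYPOTHESES BY NAME: `hLoc : GelbartRogawski1991.xiLocalPacket_nonsplit_isThetaPair`
(#75-loc; ★ p829745 `F0P2oXiLocalPacketThetaPairOfLetters` derives it from the print letters N3, K1w, U1, N6 + LABEL) and
`hDock : CMThetaDockingClauses L H Δ mH mG νH νG ξ μω (ξloc ξ) e₁ dV hdV hdV0 g hg` [Rogawski1990 Prop. 13.1.3 (d), 13.1.4; GelbartRogawski1991 Lem. 5.1.2]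
(the supercuspidal member pinned by the character identity (13.1.4) is a theta type).  CONCLUSION: every member `c` of the packet of record
`xiPacketFamilyOfRecord … ξ v` is a CM theta type — `∃ ε, ThetaTypeAtCM L H e₁ dV hdV hdV0 g hg μ1 hμ1 χf ε v c`.

PROOF.  ★ `xiPacketFamilyOfRecord_of_nonsplit`: the record at `v` is `⟨πⁿ ∘ e, some πˢ⟩` for a form congruence `e⁻¹ = cmDatumLocalCongr L v T ha h`, with
`(π², πⁿ) = keys ξ v hns` THE Keys labels of `JH(i_G(χ_ξ))` (`π²` square-integrable for `μZ v`, `πⁿ` not) and `πˢ = (hCM …).πs` the supercuspidal class read off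
(13.1.4).  (n) `c = πⁿ ∘ e`: `hLoc` at `(v, T)` gives a NON-square-integrable constituent `x₀` of `i_G(χ_ξ)` whose transport is the theta type at `εn`; by the
Keys labels `x₀ ∈ {πⁿ, π²}` and `x₀ ≠ π²` (`π²` is `L²` for `μZ v`, `x₀` is not), so `x₀ = πⁿ`.  (s) `c = πˢ`: `hDock` at the labels, `¬ πⁿ L²`, `πˢ` supercuspidal
(★ `.πs_isSupercuspidal`), `πˢ ≠ πⁿ ∘ e` (★ `.πs_ne`) and the character identity (★ `.charIdentityAt_πs`) gives `εs`.

WHAT THIS DOES NOT DO (census (iv)(α)–(γ)): it does not reach the representation-level `IsoAtXfCM σ …` of letter #75 `xiEnvelope_nonsplit_isThetaType` (needs the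
⊗′-isotypy bridge, row ISO-BRIDGE, A-p12 (g17)), it assumes membership in the RECORD family (not bare `MemXiFamily`), and it takes the docking clause on transfer
data the consumer must bind.

## References
- [Rogawski1990] J. Rogawski, *Automorphic Representations of Unitary Groups in Three Variables*, Ann. of Math. Stud. 123 — §12.2 (2) pp. 173–174; §13.1 Prop. 13.1.3 (d), Prop. 13.1.4 p. 199; §14.2 p. 232.
- [GelbartRogawski1991] S. Gelbart, J. Rogawski, *L-functions and Fourier–Jacobi coefficients for the unitary group U(3)*, Invent. Math. 105 (1991) — Lem. 5.1.2 p. 466; §1.4 pp. 450–451; Cor. 5.2.2 p. 467.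
-/

set_option autoImplicit false
-- the mandated namespace has the single-problem summit's repeated segment (`HodgeConjecture.HodgeConjecture`)
set_option linter.dupNamespace false

noncomputable section

open NumberField IsDedekindDomain MeasureTheory Filter Topology
open scoped Matrix MatrixGroups

open Literature.NumberTheory Literature.NumberTheory.Automorphic Literature.NumberTheory.Automorphic.UnitaryGroup
open Literature.NumberTheory.Automorphic.IdeleClassGroup
open Literature.NumberTheory.Automorphic.Liu2021 Literature.NumberTheory.Automorphic.Liu2021.Def411WeilCarriers
open Literature.NumberTheory.Rogawski1990 Literature.NumberTheory.GaloisRepresentations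
open Literature.NumberTheory.GelbartRogawski1991

namespace Summit.HodgeConjecture.HodgeConjecture.Cruxes.H413.F0P2oD7alphaMembersThetaClass

section Record

variable (L : Type) [Field L] [NumberField L] [IsCMField L] (H : Matrix (Fin 3) (Fin 3) L)
  (hH : (H.map (cmConjRingHom L))ᵀ = H) (hHd : IsUnit H.det) (μω : HeckeCharacter L) (hμu : μω.IsUnitary)
  -- the local data SHARED with T1's `ComparisonKit` ∕ F0P3b's `CMCharIdentityClauses` ((χ1), RULING (V28)); instance families as there (`borel` at 𝔠₀)
  [∀ v : HeightOneSpectrum (𝓞 ↥(maximalRealSubfield L)), MeasurableSpace ((cmDatum L 3 H).Local v)]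
  [∀ v : HeightOneSpectrum (𝓞 ↥(maximalRealSubfield L)),
    MeasurableSpace ((cmDatum L 2 (Matrix.of fun i j : Fin 2 => if i.val + j.val + 1 = 2 then (1 : L) else 0)).Local v ×
      (cmDatum L 1 (Matrix.of fun i j : Fin 1 => if i.val + j.val + 1 = 1 then (1 : L) else 0)).Local v)]
  [∀ (v : HeightOneSpectrum (𝓞 ↥(maximalRealSubfield L)))
      (a : ((cmDatum L 2 (Matrix.of fun i j : Fin 2 => if i.val + j.val + 1 = 2 then (1 : L) else 0)).Local v ×
        (cmDatum L 1 (Matrix.of fun i j : Fin 1 => if i.val + j.val + 1 = 1 then (1 : L) else 0)).Local v)),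
    MeasurableSpace (((cmDatum L 2 (Matrix.of fun i j : Fin 2 => if i.val + j.val + 1 = 2 then (1 : L) else 0)).Local v ×
        (cmDatum L 1 (Matrix.of fun i j : Fin 1 => if i.val + j.val + 1 = 1 then (1 : L) else 0)).Local v) ⧸
      Subgroup.centralizer ({a} : Set ((cmDatum L 2 (Matrix.of fun i j : Fin 2 => if i.val + j.val + 1 = 2 then (1 : L) else 0)).Local v ×
        (cmDatum L 1 (Matrix.of fun i j : Fin 1 => if i.val + j.val + 1 = 1 then (1 : L) else 0)).Local v)))]
  [∀ (v : HeightOneSpectrum (𝓞 ↥(maximalRealSubfield L))) (γ : (cmDatum L 3 H).Local v),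
    MeasurableSpace ((cmDatum L 3 H).Local v ⧸ Subgroup.centralizer ({γ} : Set ((cmDatum L 3 H).Local v)))]
  [∀ v : HeightOneSpectrum (𝓞 ↥(maximalRealSubfield L)), MeasurableSpace (Gqs L v ⧸ Subgroup.center (Gqs L v))]
  (Δ : ∀ v : HeightOneSpectrum (𝓞 ↥(maximalRealSubfield L)), LocalTransferFactor L H v)
  (mH : ∀ v : HeightOneSpectrum (𝓞 ↥(maximalRealSubfield L)),
    OrbitalMeasureFamily ((cmDatum L 2 (Matrix.of fun i j : Fin 2 => if i.val + j.val + 1 = 2 then (1 : L) else 0)).Local v ×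
      (cmDatum L 1 (Matrix.of fun i j : Fin 1 => if i.val + j.val + 1 = 1 then (1 : L) else 0)).Local v))
  (mG : ∀ v : HeightOneSpectrum (𝓞 ↥(maximalRealSubfield L)), OrbitalMeasureFamily ((cmDatum L 3 H).Local v))
  (νG : ∀ v : HeightOneSpectrum (𝓞 ↥(maximalRealSubfield L)), Measure ((cmDatum L 3 H).Local v))
  (νH : ∀ v : HeightOneSpectrum (𝓞 ↥(maximalRealSubfield L)),
    Measure ((cmDatum L 2 (Matrix.of fun i j : Fin 2 => if i.val + j.val + 1 = 2 then (1 : L) else 0)).Local v ×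
      (cmDatum L 1 (Matrix.of fun i j : Fin 1 => if i.val + j.val + 1 = 1 then (1 : L) else 0)).Local v))
  (ξloc : OneDimAutRepH L → ∀ v : HeightOneSpectrum (𝓞 ↥(maximalRealSubfield L)),
    (cmDatum L 2 (Matrix.of fun i j : Fin 2 => if i.val + j.val + 1 = 2 then (1 : L) else 0)).Local v ×
      (cmDatum L 1 (Matrix.of fun i j : Fin 1 => if i.val + j.val + 1 = 1 then (1 : L) else 0)).Local v →* ℂˣ)
  (μZ : ∀ v : HeightOneSpectrum (𝓞 ↥(maximalRealSubfield L)), Measure (Gqs L v ⧸ Subgroup.center (Gqs L v)))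
  (keys : ∀ (ξ : OneDimAutRepH L) (v : HeightOneSpectrum (𝓞 ↥(maximalRealSubfield L))),
    (∀ w : PlacesOver L v, IsCMField.complexConj L • w.1 = w.1) →
      {p : IrrClass (Gqs L v) × IrrClass (Gqs L v) //
        KeysCaseTwoLabels L v (μω.semilocalComponent L v) (torusLocalComponent L (IsCMField.complexConj L) v ξ.η)
          (torusLocalComponent L (IsCMField.complexConj L) v ξ.ψ) p.1 p.2 ∧
        p.1.IsSquareIntegrable (μZ v) ∧ ¬ p.2.IsSquareIntegrable (μZ v)})
  (hCM : ∀ (ξ : OneDimAutRepH L) (v : HeightOneSpectrum (𝓞 ↥(maximalRealSubfield L)))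
    (hns : ∀ w : PlacesOver L v, IsCMField.complexConj L • w.1 = w.1)
    (T : GL (Fin 3) (LocalRing L v)) (a : LocalRing L v) (ha : IsUnit a)
    (h : formCongr (conjLocal L (IsCMField.complexConj L) v) T (H.map (algebraMap L (LocalRing L v))) =
      a • (Matrix.of fun i j : Fin 3 => if i.val + j.val + 1 = 3 then (1 : L) else 0).map (algebraMap L (LocalRing L v)))
    (π2 πn : IrrClass (Gqs L v)),
    KeysCaseTwoLabels L v (μω.semilocalComponent L v) (torusLocalComponent L (IsCMField.complexConj L) v ξ.η)
      (torusLocalComponent L (IsCMField.complexConj L) v ξ.ψ) π2 πn → ¬ πn.IsSquareIntegrable (μZ v) →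
    CMNonsplitCharIdentityAt L v H (Δ v) (mH v) (mG v) (νG v) (νH v) (ξloc ξ v) (IrrClass.comap (cmDatumLocalCongr L v T ha h).symm πn))

set_option synthInstance.maxHeartbeats 400000 in
set_option maxHeartbeats 16000000 in
/-- **D7α CLASS-LEVEL GLUE: every member of the ξ-local packet family OF RECORD at a non-split place is a CM theta type**, from the local theta dichotomy
#75-loc (`hLoc`) and the theta-docking clause (`hDock`), for a dictionary pair `(μ1, χ_f)` of `ξ`.  (n) the Keys member `πⁿ ∘ e` is `hLoc`'s non-square-integrable
theta-type constituent (Keys labels: `JH(i_G(χ_ξ)) = {πⁿ, π²}`, `π²` square-integrable, so the non-`L²` constituent IS `πⁿ`); (s) the supercuspidal member `πˢ` read off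
(13.1.4) is a theta type by `hDock` (★ `.πs_isSupercuspidal`, `.πs_ne`, `.charIdentityAt_πs`).
[cite: Rogawski1990, §12.2 (2) pp. 173–174; §13.1 Prop. 13.1.3 (d), Prop. 13.1.4 p. 199] [cite: GelbartRogawski1991, Lem. 5.1.2 p. 466; §1.4 pp. 450–451] -/
theorem d7alpha_members_thetaClass
    (hLoc : Literature.NumberTheory.GelbartRogawski1991.xiLocalPacket_nonsplit_isThetaPair)
    {n' : ℕ} (e₁ : Fin 3 × Fin 1 ≃ Fin n') (dV : Fin 3 → L) (hdV : ∀ i, IsCMField.complexConj L (dV i) = dV i) (hdV0 : ∀ i, dV i ≠ 0) (g : GL (Fin 3) L)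
    (hg : ((g : Matrix (Fin 3) (Fin 3) L).map (cmConjRingHom L))ᵀ * H * (g : Matrix (Fin 3) (Fin 3) L) = Matrix.diagonal dV)
    (ξ : OneDimAutRepH L)
    (hDock : CMThetaDockingClauses L H Δ mH mG νH νG ξ μω (ξloc ξ) e₁ dV hdV hdV0 g hg)
    (hμω : ∀ x : Literature.NumberTheory.GaloisRepresentations.ideleGroup ↥(maximalRealSubfield L),
        μω (AdeleRing.ideleBaseChange (↥(maximalRealSubfield L)) L x) = quadraticHeckeCharCM L x)
    (μ1 : Literature.NumberTheory.Automorphic.IdeleClassGroup L →ₜ* Circle) (hμ1 : IsConjugateSymplectic L μ1)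
    (χf : UnitaryGroup.finAdelicOne (↥(maximalRealSubfield L)) L (IsCMField.complexConj L) →* ℂˣ)
    (hcont : Continuous χf) (hunit : ∀ z, ‖((χf z : ℂˣ) : ℂ)‖ = 1)
    -- DICTIONARY (μ): `μ̃1 = η̃⁻¹ · ψ̃⁻¹ · μω`, semi-locally at every finite place of `L⁺` (verbatim from #76)
    (hdμ : ∀ v : HeightOneSpectrum (𝓞 ↥(maximalRealSubfield L)),
        (toHeckeCharacter L μ1).semilocalComponent L v = (ξ.bcη⁻¹ * ξ.bcψ⁻¹ * μω).semilocalComponent L v)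
    -- DICTIONARY (χ_f): `χ_f (z / z̄) = (ψ̃⁻¹ · (η̃⁻¹ ψ̃⁻¹ μω)²) ((1_∞, z))` for every finite idèle `z` of `L` (verbatim from #76)
    (hdχ : ∀ z : (FiniteAdeleRing (𝓞 L) L)ˣ,
        χf (finAdelicCheck (↥(maximalRealSubfield L)) L (IsCMField.complexConj L)
            (AlgEquiv.ext fun x => by rw [AlgEquiv.mul_apply, IsCMField.complexConj_apply_apply, AlgEquiv.one_apply]) z) =
          (ξ.bcψ⁻¹ * (ξ.bcη⁻¹ * ξ.bcψ⁻¹ * μω) ^ 2)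
            (Units.map (N := AdeleRing (𝓞 L) L) (MonoidHom.inr (InfiniteAdeleRing L) (FiniteAdeleRing (𝓞 L) L)) z))
    (v : HeightOneSpectrum (𝓞 ↥(maximalRealSubfield L))) (hns : ∀ w : PlacesOver L v, IsCMField.complexConj L • w.1 = w.1)
    [BorelSpace (Gqs L v ⧸ Subgroup.center (Gqs L v))] [(μZ v).IsHaarMeasure]
    (c : IrrClass ((cmDatum L 3 H).Local v))
    (hc : c ∈ (F0P3XiPacketFamilyOfRecord.xiPacketFamilyOfRecord L H hH hHd μω hμu Δ mH mG νG νH ξloc μZ keys hCM ξ v).members) :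
    ∃ ε : (↥(maximalRealSubfield L))ˣ, ThetaTypeAtCM L H e₁ dV hdV hdV0 g hg μ1 hμ1 χf ε v c := by
  -- the record at the non-split `v`: `⟨πⁿ ∘ e, some πˢ⟩`
  obtain ⟨T, a, ha, h, hrec, -⟩ :=
    F0P3XiPacketFamilyOfRecord.xiPacketFamilyOfRecord_of_nonsplit L H hH hHd μω hμu Δ mH mG νG νH ξloc μZ keys hCM ξ v hns
  -- the Keys labels at `v`
  have hK := (keys ξ v hns).2.1
  have hs2 := (keys ξ v hns).2.2.1
  have hn := (keys ξ v hns).2.2.2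
  rw [hrec, LocalAPacket.mem_members_iff] at hc
  rcases hc with hcn | hcs
  · -- (n) the Keys member `πⁿ ∘ e`: it is `hLoc`'s non-L² theta-type constituent
    obtain ⟨εn, εs, x₀, πs', hconst, hnL2, hθn, -, -, -⟩ :=
      hLoc L H hH hHd e₁ dV hdV hdV0 g hg ξ μω hμu hμω μ1 hμ1 χf hcont hunit hdμ hdχ v hns T a ha h
    have hx₀ : x₀ = (keys ξ v hns).1.2 := by
      rcases (hK.2 x₀).1 hconst with h1 | h2
      · exact h1
      · exact absurd (h2 ▸ hs2) (hnL2 (μZ v))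
    refine ⟨εn, ?_⟩
    rw [hx₀] at hθn
    rw [hcn]
    exact hθn
  · -- (s) the supercuspidal member read off (13.1.4): docked by `hDock`
    have hci := hCM ξ v hns T a ha h (keys ξ v hns).1.1 (keys ξ v hns).1.2 hK hn
    have hcs' : c = hci.πs := (Option.some_inj.1 hcs).symm
    subst hcs'
    exact hDock μ1 hμ1 χf hcont hunit hdμ hdχ v hns T a ha h (μZ v) (keys ξ v hns).1.1 (keys ξ v hns).1.2 hK hn _
      hci.πs_isSupercuspidal hci.πs_ne hci.charIdentityAt_πs

end Record

end Summit.HodgeConjecture.HodgeConjecture.Cruxes.H413.F0P2oD7alphaMembersThetaClass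

end
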